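import Mathlib

/-!
# SoloBlind E64 — the alternating cube-sum cancellation behind the t ≥ 3 vanishing of one-prime positions

For a finite set `P` (the primes dividing a squarefree level `N`) and `y ∈ P`, the signed indicator sum
over all subsets (divisors)
`∑_{S ⊆ P} (-1)^{#S} · (if y ∈ S then 1 else -1) = if P = {y} then -2 else 0`.
In the covering computation for the Eisenstein cuspidal class `c = ∑_{d ∣ N} (-1)^{ω(d)} P_d` this is the
exponent of `y` in the `U_{N/x}`-position of `c` (with `P` = the primes dividing `N/x`); it vanishes
whenever `P ≠ {y}`, which is the cancellation making all one-prime positions trivial for three or more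
primes (for two primes `P = {y}` and the sum is `-2`: the non-trivial case, THEOREM V).
-/

namespace Summit.Langlands.Langlands.Theorems

open Finset

/-- Signed indicator: `+1` on subsets containing `y`, `-1` otherwise. -/
def signedInd (y : ℕ) (S : Finset ℕ) : ℤ := if y ∈ S then 1 else -1

/-- `signedInd y S = 1` when `y ∈ S`. -/
theorem signedInd_of_mem {y : ℕ} {S : Finset ℕ} (h : y ∈ S) : signedInd y S = 1 := by
  simp [signedInd, h]

/-- `signedInd y S = -1` when `y ∉ S`. -/
theorem signedInd_of_not_mem {y : ℕ} {S : Finset ℕ} (h : y ∉ S) : signedInd y S = -1 := by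
  simp [signedInd, h]

/-- The alternating sum of the signed indicator over the power set of `Q` with `y ∉ Q`,
split along `insert y`: it equals `-2 · ∑_{S ⊆ Q} (-1)^{#S}`. -/
theorem alt_sum_signedInd_insert (Q : Finset ℕ) (y : ℕ) (hy : y ∉ Q) :
    (∑ S ∈ (insert y Q).powerset, (-1 : ℤ) ^ S.card * signedInd y S)
      = -2 * ∑ S ∈ Q.powerset, (-1 : ℤ) ^ S.card := by
  rw [Finset.sum_powerset_insert hy]
  have h1 : (∑ S ∈ Q.powerset, (-1 : ℤ) ^ S.card * signedInd y S)
      = ∑ S ∈ Q.powerset, -((-1 : ℤ) ^ S.card) := by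
    refine Finset.sum_congr rfl ?_
    intro S hS
    have hSQ : S ⊆ Q := Finset.mem_powerset.mp hS
    have hyS : y ∉ S := fun h => hy (hSQ h)
    rw [signedInd_of_not_mem hyS]
    ring
  have h2 : (∑ S ∈ Q.powerset, (-1 : ℤ) ^ (insert y S).card * signedInd y (insert y S))
      = ∑ S ∈ Q.powerset, -((-1 : ℤ) ^ S.card) := by
    refine Finset.sum_congr rfl ?_
    intro S hS
    have hSQ : S ⊆ Q := Finset.mem_powerset.mp hS
    have hyS : y ∉ S := fun h => hy (hSQ h)
    rw [signedInd_of_mem (Finset.mem_insert_self y S), Finset.card_insert_of_notMem hyS]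
    ring
  rw [h1, h2, Finset.sum_neg_distrib]
  ring

/-- MAIN IDENTITY. For `y ∈ P`:
`∑_{S ⊆ P} (-1)^{#S} · signedInd y S = if P = {y} then -2 else 0`. -/
theorem alt_sum_signedInd (P : Finset ℕ) (y : ℕ) (hy : y ∈ P) :
    (∑ S ∈ P.powerset, (-1 : ℤ) ^ S.card * signedInd y S) = if P = {y} then -2 else 0 := by
  have hP : P = insert y (P.erase y) := (Finset.insert_erase hy).symm
  rw [hP, alt_sum_signedInd_insert (P.erase y) y (Finset.notMem_erase y P),
    Finset.sum_powerset_neg_one_pow_card]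
  rw [← hP]
  by_cases h : P = {y}
  · subst h
    simp
  · have hne : P.erase y ≠ ∅ := by
      intro he
      rcases (Finset.erase_eq_empty_iff P y).mp he with h0 | h0
      · subst h0; simp at hy
      · exact h h0
    simp [h, hne]

/-- COROLLARY (the cancellation for three or more primes): if `P` has an element other than `y`,
the signed alternating sum vanishes. -/
theorem alt_sum_signedInd_eq_zero (P : Finset ℕ) (y z : ℕ) (hy : y ∈ P) (hz : z ∈ P) (hyz : z ≠ y) :
    (∑ S ∈ P.powerset, (-1 : ℤ) ^ S.card * signedInd y S) = 0 := by
  rw [alt_sum_signedInd P y hy]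
  have h : P ≠ {y} := by
    intro hP
    rw [hP, Finset.mem_singleton] at hz
    exact hyz hz
  simp [h]

end Summit.Langlands.Langlands.Theorems
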